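import Literature.InformationTheory.QuantumCodes.UnionFindDecoderRadius
import HarnessLib

/-!
# Algorithm 1's sequential narration equals the synchronous round (Union-Find decoder, toric code)

Topic `Literature/InformationTheory/QuantumCodes` (qec cell, LIT-2 lane «union-find», PARTITION v2.48 D50.L7 «L-UF»).
PROVED, no named fact, no sorry.

Delfosse–Nickerson 2021 (arXiv:1709.06218) narrate one pass of the while-loop of Algorithm 1 SEQUENTIALLY —
"Run over the list of odd clusters and do: Grow `C_i` by increasing its radius by one half-edge. If `C_i` meets
another cluster, fuse and update parity. If `C_i` is even, remove it from the odd cluster list" (§2, steps 3–6) —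
while the implementation, Algorithm 2's `Grow(𝓛)` (§4.2 (i)–(ii)), grows ALL odd clusters by one half-edge and
then fuses: the synchronous round `UnionFind.step` of `UnionFindDecoder.lean`, for which Theorem 1 is proved in
`UnionFindDecoderRadius.lean`. This file proves that the two readings agree: for EVERY order of the list of odd
clusters, processing them one at a time — each cluster, at its turn, grows by one half-edge in all directions if
it is still odd, fusions and parities being updated immediately (`turn`, `stepSeq`) — yields exactly the
synchronous round (`stepSeq_eq_step`), hence the same states after every pass (`stateSeq_eq_state`), the same
grown erasure and the same outputs; so Theorem 1 (`DelfosseNickerson2021_theorem1_toric`) covers the sequential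
narration with any list order as well (`isOutputSeq_iff`).

The reason is the synchronisation invariant `SyncInv` (`syncInv_state`): within a pass, a cluster that has not
yet had its turn is untouched by the earlier turns — in a near-type pass the earlier clusters only grow their own
halves, which complete no link towards a near-type site; in a far-type pass two distinct odd clusters are never
joined by a non-full link (both ends would own their halves) — so at its turn it is still odd, still the same
cluster, and grows exactly the halves it would have grown synchronously (`turn_midState`).

## References
[cite: DelfosseNickerson2021, §2 Algorithm 1 (steps 3–6: "Run over the list of odd clusters …"), §4.2 Algorithm 2 (Grow: "(i) Growth: Grow all the clusters … (ii) Fusion")]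
-/

noncomputable section

namespace Literature.InformationTheory.QuantumCodes

namespace ToricCode

namespace UnionFind

open Finset

variable {L : ℕ} [NeZero L]

/-! ### The sequential pass -/

open Classical in
/-- **One turn** of Algorithm 1's inner loop at the listed site `v`: if the CURRENT cluster of `v` is odd, every one
of its sites acts (the cluster grows by one half-edge in all directions; fusions are implicit in the new state),
otherwise nothing happens ("if `C_i` is even, remove it from the odd cluster list").
[cite: DelfosseNickerson2021, §2 Algorithm 1 (steps 4–6)] -/
def turn (σ : Syndrome L) (T : Finset (Half L)) (v : Vertex L) : Finset (Half L) :=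
  if charge σ T v = 1 then T ∪ (comp T v).biUnion (grow T) else T

/-- **One sequential pass** over a list of (representatives of) odd clusters, in the given order.
[cite: DelfosseNickerson2021, §2 Algorithm 1 (step 3: "Run over the list of odd clusters and do")] -/
def stepSeq (σ : Syndrome L) (S : Finset (Half L)) (l : List (Vertex L)) : Finset (Half L) :=
  l.foldl (turn σ) S

/-- The state in the middle of a pass: the round-start state plus the growth of the sites already processed.
[cite: DelfosseNickerson2021, §2 Algorithm 1 (steps 3–6)] -/
def midState (S : Finset (Half L)) (P : Finset (Vertex L)) : Finset (Half L) :=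
  S ∪ P.biUnion (grow S)

omit [NeZero L] in
/-- Membership in a mid-pass state. [cite: DelfosseNickerson2021, §2 Algorithm 1 (steps 3–6)] -/
theorem mem_midState {S : Finset (Half L)} {P : Finset (Vertex L)} {h : Half L} :
    h ∈ midState S P ↔ h ∈ S ∨ ∃ x ∈ P, h ∈ grow S x := by
  simp [midState]

omit [NeZero L] in
/-- The round-start state is contained in every mid-pass state. [cite: DelfosseNickerson2021, §2 Algorithm 1] -/
theorem subset_midState (S : Finset (Half L)) (P : Finset (Vertex L)) : S ⊆ midState S P :=
  Finset.subset_union_left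

omit [NeZero L] in
/-- A half grown earlier in the pass was grown by a processed site acting on a non-full slot.
[cite: DelfosseNickerson2021, §2 Algorithm 1 (step 4)] -/
theorem exists_act_of_mem_midState {S : Finset (Half L)} {P : Finset (Vertex L)} {h : Half L}
    (hT : h ∈ midState S P) (hS : h ∉ S) : ∃ x ∈ P, ∃ h₀ ∈ slots x, ¬ IsFull S h₀.1 ∧ h = act S h₀ := by
  rcases mem_midState.1 hT with h' | ⟨x, hx, hg⟩
  · exact absurd h' hS
  · obtain ⟨h₀, hh₀, rfl⟩ := Finset.mem_image.1 hg
    exact ⟨x, hx, h₀, (Finset.mem_filter.1 hh₀).1, (Finset.mem_filter.1 hh₀).2, rfl⟩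

omit [NeZero L] in
/-- In a near-type pass the halves grown so far sit at processed sites. [cite: DelfosseNickerson2021, §2 Algorithm 2 (Support 0 → 1/2)] -/
theorem near_midState_new {S : Finset (Half L)} {P : Finset (Vertex L)} (hN : ∀ x ∈ P, NearType S x) {h : Half L}
    (hT : h ∈ midState S P) (hS : h ∉ S) : h.vert ∈ P := by
  obtain ⟨x, hx, h₀, hh₀, hfull, rfl⟩ := exists_act_of_mem_midState hT hS
  rw [act, if_neg (hN x hx h₀ hh₀ hfull), mem_slots_iff.1 hh₀]
  exact hx

omit [NeZero L] in
/-- In a far-type pass the halves grown so far are far halves of slots owned by processed sites.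
[cite: DelfosseNickerson2021, §2 Algorithm 2 (Support 1/2 → 1)] -/
theorem far_midState_new {S : Finset (Half L)} {P : Finset (Vertex L)} (hF : ∀ x ∈ P, FarType S x) {h : Half L}
    (hT : h ∈ midState S P) (hS : h ∉ S) : h.other.vert ∈ P ∧ h.other ∈ S := by
  obtain ⟨x, hx, h₀, hh₀, hfull, rfl⟩ := exists_act_of_mem_midState hT hS
  have h₀S : h₀ ∈ S := hF x hx h₀ hh₀ hfull
  rw [act, if_pos h₀S, Half.other_other, mem_slots_iff.1 hh₀]
  exact ⟨hx, h₀S⟩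

/-! ### The frame property: an unprocessed odd cluster is untouched -/

/-- **Frame property (clusters).** During a pass, a cluster none of whose sites has been processed, and whose sites
have the type of the pass, is still the same cluster. [cite: DelfosseNickerson2021, §2 Algorithm 1 (step 5: fusions) with Algorithm 2 (Support table)] -/
theorem comp_midState_eq {σ : Syndrome L} {S : Finset (Half L)} (hinv : SyncInv σ S) {P : Finset (Vertex L)}
    (hP : ∀ x ∈ P, charge σ S x = 1) {z : Vertex L} (hz : charge σ S z = 1) (hdis : ∀ y ∈ comp S z, y ∉ P) :
    comp (midState S P) z = comp S z := by
  refine Finset.Subset.antisymm (fun w hw => ?_) (comp_mono (subset_midState S P) z)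
  by_contra hw'
  obtain ⟨x', hx', h, hhx, hfullT, hfullS⟩ := exists_exit hw hw'
  have hx'odd : charge σ S x' = 1 := by rw [charge_eq_of_mem_comp hx', hz]
  have hslot : h ∈ slots x' := mem_slots_iff.2 hhx
  obtain ⟨hT, hoT⟩ := isFull_iff_mem_and_other_mem.1 hfullT
  rcases hinv.1 with hN | hF
  · -- near-type pass: `h` cannot be old (x' is of near type) nor new (it would sit at a processed site)
    by_cases hS : h ∈ S
    · exact hN x' hx'odd h hslot hfullS hS
    · exact hdis x' hx' (hhx ▸ near_midState_new (fun x hx => hN x (hP x hx)) hT hS)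
  · -- far-type pass: `h` is old (x' is of far type), so `h.other` is new, grown from the site of `h` — processed
    have hS : h ∈ S := hF x' hx'odd h hslot hfullS
    have hoS : h.other ∉ S := fun hoS => hfullS (isFull_iff_mem_and_other_mem.2 ⟨hS, hoS⟩)
    have := (far_midState_new (fun x hx => hF x (hP x hx)) hoT hoS).1
    rw [Half.other_other, hhx] at this
    exact hdis x' hx' this

/-- **Frame property (growth).** During a pass, a site of an unprocessed odd cluster would grow exactly the halves it
grows from the round-start state. [cite: DelfosseNickerson2021, §2 Algorithm 1 (step 4) with Algorithm 2 (Support table)] -/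
theorem grow_midState_eq {σ : Syndrome L} {S : Finset (Half L)} (hinv : SyncInv σ S) {P : Finset (Vertex L)}
    (hP : ∀ x ∈ P, charge σ S x = 1) {y : Vertex L} (hy : charge σ S y = 1) (hyP : y ∉ P) :
    grow (midState S P) y = grow S y := by
  -- on the slots of `y`: fullness and ownership are unchanged
  have hfull : ∀ h ∈ slots y, (IsFull (midState S P) h.1 ↔ IsFull S h.1) := by
    intro h hh
    refine ⟨fun hT => ?_, fun hS => hS.mono (subset_midState S P)⟩
    by_contra hS
    obtain ⟨hT1, hoT⟩ := isFull_iff_mem_and_other_mem.1 hT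
    rcases hinv.1 with hN | hF
    · have hnot : h ∉ S := hN y hy h hh hS
      exact hyP ((mem_slots_iff.1 hh) ▸ near_midState_new (fun x hx => hN x (hP x hx)) hT1 hnot)
    · have hmem : h ∈ S := hF y hy h hh hS
      have hoS : h.other ∉ S := fun hoS => hS (isFull_iff_mem_and_other_mem.2 ⟨hmem, hoS⟩)
      have := (far_midState_new (fun x hx => hF x (hP x hx)) hoT hoS).1
      rw [Half.other_other, mem_slots_iff.1 hh] at this
      exact hyP this
  have hmem : ∀ h ∈ slots y, ¬ IsFull S h.1 → (h ∈ midState S P ↔ h ∈ S) := by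
    intro h hh hS
    refine ⟨fun hT => ?_, fun h' => subset_midState S P h'⟩
    by_contra hnot
    rcases hinv.1 with hN | hF
    · exact hyP ((mem_slots_iff.1 hh) ▸ near_midState_new (fun x hx => hN x (hP x hx)) hT hnot)
    · exact hnot (hF y hy h hh hS)
  unfold grow
  have hfilter : ((slots y).filter fun h => ¬ IsFull (midState S P) h.1) =
      (slots y).filter fun h => ¬ IsFull S h.1 :=
    Finset.filter_congr fun h hh => by rw [hfull h hh]
  rw [hfilter]
  refine Finset.image_congr fun h hh => ?_
  obtain ⟨hh, hS⟩ := Finset.mem_filter.1 (Finset.mem_coe.1 hh)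
  unfold act
  rw [if_congr (hmem h hh hS) rfl rfl]

/-- **One turn of an unprocessed odd cluster adds exactly its synchronous growth.**
[cite: DelfosseNickerson2021, §2 Algorithm 1 (steps 4–6) = §4.2 Algorithm 2 Grow (i)–(ii)] -/
theorem turn_midState {σ : Syndrome L} {S : Finset (Half L)} (hinv : SyncInv σ S) {P : Finset (Vertex L)}
    (hP : ∀ x ∈ P, charge σ S x = 1) {z : Vertex L} (hz : charge σ S z = 1) (hdis : ∀ y ∈ comp S z, y ∉ P) :
    turn σ (midState S P) z = midState S (P ∪ comp S z) := by
  have hcomp := comp_midState_eq hinv hP hz hdis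
  have hcharge : charge σ (midState S P) z = 1 := by rw [charge, hcomp, ← charge, hz]
  rw [turn, if_pos hcharge, hcomp]
  have hg : (comp S z).biUnion (grow (midState S P)) = (comp S z).biUnion (grow S) :=
    Finset.biUnion_congr rfl fun y hy =>
      grow_midState_eq hinv hP (by rw [charge_eq_of_mem_comp hy, hz]) (hdis y hy)
  rw [hg, midState, midState, Finset.union_biUnion, Finset.union_assoc]

/-- **A whole pass over distinct, unprocessed odd clusters adds exactly their synchronous growth.**
[cite: DelfosseNickerson2021, §2 Algorithm 1 (steps 3–6)] -/
theorem foldl_turn_midState {σ : Syndrome L} {S : Finset (Half L)} (hinv : SyncInv σ S) :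
    ∀ (l : List (Vertex L)) (P : Finset (Vertex L)), (∀ x ∈ P, charge σ S x = 1) →
      (∀ v ∈ l, charge σ S v = 1) → (∀ v ∈ l, ∀ y ∈ comp S v, y ∉ P) →
      l.Pairwise (fun u v => comp S u ≠ comp S v) →
      l.foldl (turn σ) (midState S P) = midState S (P ∪ l.toFinset.biUnion (comp S))
  | [], P, _, _, _, _ => by simp [midState]
  | v :: l, P, hP, hodd, hdis, hpw => by
    rw [List.foldl_cons, turn_midState hinv hP (hodd v (by simp)) (hdis v (by simp))]
    have hpw' := List.pairwise_cons.1 hpw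
    rw [foldl_turn_midState hinv l (P ∪ comp S v) ?_ (fun u hu => hodd u (by simp [hu])) ?_ hpw'.2]
    · rw [List.toFinset_cons, Finset.biUnion_insert, Finset.union_assoc]
    · intro x hx
      rcases Finset.mem_union.1 hx with hx | hx
      · exact hP x hx
      · rw [charge_eq_of_mem_comp hx]; exact hodd v (by simp)
    · intro u hu y hy hyP
      rcases Finset.mem_union.1 hyP with hyP | hyv
      · exact hdis u (by simp [hu]) y hy hyP
      · exact hpw'.1 u hu ((comp_eq_comp_of_mem hyv).symm.trans (comp_eq_comp_of_mem hy))

/-- A list of sites **represents the odd clusters** of a state: every listed site lies in an odd cluster, no two in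
the same one, and every odd cluster is listed. (Any order.) [cite: DelfosseNickerson2021, §2 Algorithm 1 (steps 1, 3: "the list of all odd clusters")] -/
def IsRepList (σ : Syndrome L) (S : Finset (Half L)) (l : List (Vertex L)) : Prop :=
  (∀ v ∈ l, charge σ S v = 1) ∧ l.Pairwise (fun u v => comp S u ≠ comp S v) ∧
    ∀ x, charge σ S x = 1 → ∃ v ∈ l, x ∈ comp S v

/-- **The sequential pass equals the synchronous round**, for every order of the list of odd clusters, whenever the
state satisfies the synchronisation invariant (every reachable state does, `syncInv_state`).
[cite: DelfosseNickerson2021, §2 Algorithm 1 (steps 3–6) versus §4.2 Algorithm 2 Grow (i)–(ii)] -/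
theorem stepSeq_eq_step {σ : Syndrome L} {S : Finset (Half L)} (hinv : SyncInv σ S) {l : List (Vertex L)}
    (hl : IsRepList σ S l) : stepSeq σ S l = step σ S := by
  obtain ⟨hodd, hpw, hcov⟩ := hl
  have h0 : midState S ∅ = S := by simp [midState]
  rw [stepSeq]
  conv_lhs => rw [← h0]
  rw [foldl_turn_midState hinv l ∅ (by simp) hodd (by simp) hpw, Finset.empty_union]
  ext h
  rw [mem_midState, mem_step]
  constructor
  · rintro (hS | ⟨y, hy, hg⟩)
    · exact Or.inl hS
    · obtain ⟨v, hv, hyv⟩ := Finset.mem_biUnion.1 hy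
      exact Or.inr ⟨y, by rw [charge_eq_of_mem_comp hyv]; exact hodd v (List.mem_toFinset.1 hv), hg⟩
  · rintro (hS | ⟨y, hy, hg⟩)
    · exact Or.inl hS
    · obtain ⟨v, hv, hyv⟩ := hcov y hy
      exact Or.inr ⟨y, Finset.mem_biUnion.2 ⟨v, List.mem_toFinset.2 hv, hyv⟩, hg⟩

/-! ### All passes: the sequential states are the synchronous states -/

/-- The states of the SEQUENTIAL narration of Algorithm 1, the list of odd clusters of each pass being ordered by
an arbitrary rule `ord`. [cite: DelfosseNickerson2021, §2 Algorithm 1 (while loop, steps 3–6)] -/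
def stateSeq (ord : Finset (Half L) → List (Vertex L)) (σ : Syndrome L) (R : Finset (Edge L)) : ℕ → Finset (Half L)
  | 0 => initial R
  | n + 1 => stepSeq σ (stateSeq ord σ R n) (ord (stateSeq ord σ R n))

/-- **Order invariance.** For every rule listing the odd clusters of each pass in any order, the sequential states
coincide with the synchronous states `state σ R n` after every pass.
[cite: DelfosseNickerson2021, §2 Algorithm 1 versus §4.2 Algorithm 2] -/
theorem stateSeq_eq_state {ord : Finset (Half L) → List (Vertex L)} {σ : Syndrome L} {R : Finset (Edge L)}
    (hord : ∀ S, IsRepList σ S (ord S)) : ∀ n, stateSeq ord σ R n = state σ R n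
  | 0 => rfl
  | n + 1 => by
    rw [stateSeq, stateSeq_eq_state hord n, state_succ]
    exact stepSeq_eq_step (syncInv_state σ R n) (hord _)

/-- Hence the sequential narration has the same grown erasure and the SAME valid outputs as the synchronous
process: `C` is supported on the full links of the sequential final state with syndrome `σ` iff `IsOutput σ R C`;
in particular Theorem 1 (`DelfosseNickerson2021_theorem1_toric`) applies verbatim to every list order.
[cite: DelfosseNickerson2021, §2 Algorithm 1 (step 8), §3 Theorem 1] -/
theorem isOutputSeq_iff {ord : Finset (Half L) → List (Vertex L)} {σ : Syndrome L} {R : Finset (Edge L)}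
    (hord : ∀ S, IsRepList σ S (ord S)) (C : Chain L) :
    ((∀ ℓ, C ℓ ≠ 0 → IsFull (stateSeq ord σ R (horizon L)) ℓ) ∧ syn L C = σ) ↔ IsOutput σ R C := by
  rw [stateSeq_eq_state hord]
  rfl

/-- A representative list always exists (so the hypothesis of `stateSeq_eq_state` is satisfiable by SOME rule, and
by any rule obtained from it by reordering). [cite: DelfosseNickerson2021, §2 Algorithm 1 (step 1: "Create the list of all odd clusters")] -/
theorem exists_isRepList (σ : Syndrome L) (S : Finset (Half L)) : ∃ l : List (Vertex L), IsRepList σ S l := by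
  classical
  -- one representative per odd cluster: choose, for each odd cluster `K`, some site of charge 1 inside it
  let Ks := ((univ : Finset (Vertex L)).filter fun v => charge σ S v = 1).image (comp S)
  have hK : ∀ K ∈ Ks, ∃ v, charge σ S v = 1 ∧ comp S v = K := fun K hK => by
    obtain ⟨v, hv, rfl⟩ := Finset.mem_image.1 hK
    exact ⟨v, (Finset.mem_filter.1 hv).2, rfl⟩
  choose f hf using hK
  refine ⟨(Ks.attach.toList).map fun K => f K.1 K.2, ?_, ?_, ?_⟩
  · intro v hv
    obtain ⟨K, -, rfl⟩ := List.mem_map.1 hv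
    exact (hf K.1 K.2).1
  · rw [List.pairwise_map]
    exact List.Pairwise.imp (R := fun K K' : Ks => K ≠ K')
      (fun {K K'} (hne : K ≠ K') (heq : comp S (f K.1 K.2) = comp S (f K'.1 K'.2)) =>
        hne (Subtype.ext (by rw [← (hf K.1 K.2).2, ← (hf K'.1 K'.2).2]; exact heq)))
      (Finset.nodup_toList _)
  · intro x hx
    have hxK : comp S x ∈ Ks := Finset.mem_image.2 ⟨x, Finset.mem_filter.2 ⟨Finset.mem_univ _, hx⟩, rfl⟩
    refine ⟨f _ hxK, List.mem_map.2 ⟨⟨_, hxK⟩, Finset.mem_toList.2 (Finset.mem_attach _ _), rfl⟩, ?_⟩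
    rw [(hf _ hxK).2]
    exact mem_comp_self S x

end UnionFind

end ToricCode

end Literature.InformationTheory.QuantumCodes
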